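import Literature.NumberTheory.EllipticCurves.TateParametrisationTorsion
import HarnessLib

/-!
# Tate parametrisations and the `p`-torsion of `E(K̄_v)`, II: the twisted (non-split) case

`Proofs`-style file (theorems only: no definition, no named fact) in topic
`NumberTheory/EllipticCurves`, sequel to `TateParametrisationTorsion.lean`. Elementary consequences
of the SHAPE of a TWISTED Tate parametrisation — an additive homomorphism
`Φ : K̄_v^* → E(K̄_v)` with kernel `q^ℤ`, `0 < |q|_v < 1`, and `σ • Φ(u) = Φ((σu)^{ε(σ)})`,
`ε(σ) = ±1` the quadratic character of `K_v(√γ)/K_v` — as provided by the named fact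
`Silverman1994_thmV53_corV54_tateUniformisation` (`TateUniformisation.lean`; Silverman *ATAEC*
V.5.2 (c), V.5.3, Cor. V.5.4: uniformisation of a curve with multiplicative reduction, split or
non-split); the fact itself is NOT used here (everything enters as explicit hypotheses), so nothing
is conditional. Consumer: `CongruenceVisibilityMultiplicativeTwisted.lean` (the local Kummer
conditions of two `p`-congruent curves agree at a place where both have multiplicative reduction of
the same twist type; cell `b2b-bsdres`, whose HONEST FRAMING applies to that use: delete the
COMBINATION-shaped residual classes of rank `≤ 1` curves from PUBLISHED theorems only, type the
construction-shaped remainder; not "finishing BSD").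

* `exists_eq_nsmul_or_forall_map_eq_self` — **the twisted dichotomy**: for a primitive `p`-th root
  of unity `ζ₀`, `L₁ = Φ(ζ₀)` and a `p`-torsion point `L₂` on which `Γ_{K_v}` acts as on `L₁`
  (`(σζ₀)^{ε(σ)} = ζ₀^c ⇒ σL₂ = cL₂`), either `L₂ ∈ ℤ L₁` or every `σ ∈ Γ_{K_v}` fixes `ζ₀`
  (same linear algebra in the `𝔽_p`-plane `E[p]` as in the split case; the point `X₀ = Φ(w₀)`,
  `w₀^p = q`, now satisfies `σX₀ = ε(σ)X₀ + ε(σ)k L₁`, forcing the scalar by which `σ` acts on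
  `E[p]` to be `ε(σ)`, i.e. `σζ₀ = ζ₀`);
* `false_of_forall_map_primitiveRoot_eq` — if `K_v` has no non-trivial `p`-th root of unity, then
  `Γ_{K_v}` does not fix `ζ₀` (Galois descent `K̄_v^{Γ_{K_v}} = K_v`, Mathlib
  `InfiniteGalois.mem_range_algebraMap_iff_fixed`);
* `exists_twistInvariant_lift` — for `u ∈ L^*`, `L = K_v(t)`, with `u · σ(u) ∈ q^ℤ` for the
  `σ` moving `t` (the shape of the `K_v`-rational points, Cor. V.5.4), the element
  `u' = u^{2k} q^{-km}` is invariant under the twisted action and `Φ(u') = 2k · Φ(u)`.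

References: [SilvermanATAEC1994] J. H. Silverman, *Advanced Topics in the Arithmetic of Elliptic
Curves*, GTM 151, Ch. V §5 (Lemma 5.2, Thm. 5.3, Cor. 5.4); [SilvermanAEC2009] III.6.4, VIII.§1.
-/

noncomputable section

open scoped Classical

open NumberField IsDedekindDomain Field

namespace WeierstrassCurve

open Literature.NumberTheory.EllipticCurves Literature.NumberTheory.GaloisRepresentations Field
open NumberField IsDedekindDomain

section Local

variable {K : Type} [Field K] [NumberField K] (W : WeierstrassCurve K) [W.IsElliptic]
  {p : ℕ} [hp : Fact p.Prime] (v : HeightOneSpectrum (𝓞 K))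

/-- **Twisted dichotomy.** As `exists_eq_nsmul_or_forall_smul_eq`, for a Tate parametrisation with
TWISTED equivariance `σ • Φ(u) = Φ((σu)^{ε(σ)})`, `ε(σ) = ±1`: for a primitive `p`-th root of unity
`ζ₀` and a `p`-torsion point `L₂` on which `Γ_{K_v}` acts as it does on `L₁ = Φ(ζ₀)`
(`(σζ₀)^{ε(σ)} = ζ₀^c ⇒ σL₂ = cL₂`), either `L₂ ∈ ℤ L₁` or every `σ ∈ Γ_{K_v}` FIXES `ζ₀`
(i.e. `ζ₀ ∈ K_v`). [folklore] -/
theorem exists_eq_nsmul_or_forall_map_eq_self {q : (v.adicCompletion K)} (hq0 : q ≠ 0)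
    (hq1 : Valued.v q < 1)
    (Φ : Additive (AlgebraicClosure (v.adicCompletion K))ˣ →+ localPoints W (v.adicCompletion K))
    (hker : ∀ u : (AlgebraicClosure (v.adicCompletion K))ˣ, Φ (Additive.ofMul u) = 0 ↔ ∃ n : ℤ,
        (u : (AlgebraicClosure (v.adicCompletion K))) = algebraMap (v.adicCompletion K)
        (AlgebraicClosure (v.adicCompletion K)) q ^ n)
    (ε : (absoluteGaloisGroup (v.adicCompletion K)) → ℤ) (hε : ∀ σ, ε σ = 1 ∨ ε σ = -1)
    (hequiv : ∀ (σ : (absoluteGaloisGroup (v.adicCompletion K))) (u : (AlgebraicClosure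
        (v.adicCompletion K))ˣ),
      σ • Φ (Additive.ofMul u) = Φ (Additive.ofMul ((Units.map
          (absoluteGaloisGroup.toAlgEquiv _ σ : AlgebraicClosure (v.adicCompletion K)
          →* AlgebraicClosure (v.adicCompletion K)) u) ^ (ε σ))))
    {Z : (AlgebraicClosure (v.adicCompletion K))ˣ} (hZ : IsPrimitiveRoot (Z : (AlgebraicClosure
        (v.adicCompletion K))) p)
    {L₂ : localPoints W (v.adicCompletion K)} (hL₂p : (p : ℤ) • L₂ = 0)
    (hL₂σ : ∀ (σ : (absoluteGaloisGroup (v.adicCompletion K))) (c : ℕ), (Units.map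
        (absoluteGaloisGroup.toAlgEquiv _ σ : AlgebraicClosure (v.adicCompletion K)
        →* AlgebraicClosure (v.adicCompletion K)) Z) ^ (ε σ) = Z ^ c → σ • L₂ = c • L₂) :
    (∃ a : ℕ, L₂ = a • Φ (Additive.ofMul Z)) ∨ ∀ σ : (absoluteGaloisGroup (v.adicCompletion K)),
        Units.map (absoluteGaloisGroup.toAlgEquiv _ σ : AlgebraicClosure (v.adicCompletion K)
        →* AlgebraicClosure (v.adicCompletion K)) Z = Z := by
  classical
  by_cases hA : ∃ a : ℕ, L₂ = a • Φ (Additive.ofMul Z)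
  · exact Or.inl hA
  right
  have hA' : ∀ a : ℕ, L₂ ≠ a • Φ (Additive.ofMul Z) := fun a h ↦ hA ⟨a, h⟩
  have hpp : p.Prime := hp.out
  haveI : NeZero p := ⟨hpp.ne_zero⟩
  haveI : CharZero (v.adicCompletion K) := charZero_adicCompletion v
  have hn : (p : ℤ) ≠ 0 := by exact_mod_cast hpp.ne_zero
  have hq' : algebraMap (v.adicCompletion K) (AlgebraicClosure (v.adicCompletion K)) q ≠ 0 := by
    rw [Ne, map_eq_zero_iff _ (algebraMap (v.adicCompletion K) (AlgebraicClosure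
        (v.adicCompletion K))).injective]; exact hq0
  have hεsq : ∀ σ, ε σ * ε σ = 1 := fun σ ↦ by rcases hε σ with h | h <;> simp [h]
  -- the line `L₁ = Φ(ζ₀)`
  set L₁ : localPoints W (v.adicCompletion K) := Φ (Additive.ofMul Z) with hL₁
  have hZp : Z ^ p = 1 := Units.ext (by rw [Units.val_pow_eq_pow_val, hZ.pow_eq_one, Units.val_one])
  have hZzpow : ∀ a b : ℤ, (p : ℤ) ∣ a - b → Z ^ a = Z ^ b := by
    intro a b ⟨t, ht⟩
    rw [show a = b + p * t by linarith, zpow_add, zpow_mul, zpow_natCast, hZp, one_zpow, mul_one]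
  have hL₁p : (p : ℤ) • L₁ = 0 := W.zsmul_map_ofMul_eq_zero_of_pow_eq_one v Φ hZp
  have hL₁0 : L₁ ≠ 0 :=
    W.map_ofMul_ne_zero_of_pow_eq_one v hq0 hq1 Φ hker hZp
      (fun h ↦ hZ.ne_one hpp.one_lt (by rw [h, Units.val_one]))
  -- `Γ_{K_v}` acts on `ζ₀^{±1}`, `L₁`, `L₂` through the cyclotomic character
  have hcyc : ∀ σ : (absoluteGaloisGroup (v.adicCompletion K)), ∃ c : ℕ, (Units.map
      (absoluteGaloisGroup.toAlgEquiv _ σ : AlgebraicClosure (v.adicCompletion K)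
      →* AlgebraicClosure (v.adicCompletion K)) Z) ^ (ε σ) = Z ^ c := by
    intro σ
    have h1 : (((Units.map (absoluteGaloisGroup.toAlgEquiv _ σ : AlgebraicClosure
        (v.adicCompletion K) →* AlgebraicClosure (v.adicCompletion K)) Z) ^ (ε σ) :
        (AlgebraicClosure (v.adicCompletion K))ˣ) : (AlgebraicClosure (v.adicCompletion K))) ^ p
        = 1 := by
      rw [← Units.val_pow_eq_pow_val, ← zpow_natCast, ← zpow_mul, mul_comm, zpow_mul, zpow_natCast,
        ← map_pow, hZp, map_one, one_zpow, Units.val_one]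
    obtain ⟨c, -, hc⟩ := hZ.eq_pow_of_pow_eq_one h1
    exact ⟨c, Units.ext (by rw [← hc, Units.val_pow_eq_pow_val])⟩
  have hL₁σ : ∀ (σ : (absoluteGaloisGroup (v.adicCompletion K))) (c : ℕ), (Units.map
      (absoluteGaloisGroup.toAlgEquiv _ σ : AlgebraicClosure (v.adicCompletion K)
      →* AlgebraicClosure (v.adicCompletion K)) Z) ^ (ε σ) = Z ^ c → σ • L₁ = c • L₁ := by
    intro σ c hc
    rw [hL₁, hequiv, hc, ofMul_pow, map_nsmul]
  -- the `𝔽_p`-plane `E[p]`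
  set Tor := AddSubgroup.torsionBy (localPoints W (v.adicCompletion K)) (p : ℤ) with hTor
  letI : Module (ZMod p) Tor := AddSubgroup.torsionBy.zmodModule
  have hcardTor : Nat.card Tor = p ^ 2 := by
    rw [hTor, W.natCard_torsionBy_localPoints (E := (v.adicCompletion K)) (p : ℤ) hn,
        Int.natAbs_natCast]
  haveI : Finite Tor := Nat.finite_of_card_ne_zero
      (by rw [hcardTor]; exact pow_ne_zero 2 hpp.ne_zero)
  haveI : Module.Finite (ZMod p) Tor := Module.Finite.of_finite
  have hrank : Module.finrank (ZMod p) Tor = 2 := by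
    have h := Module.natCard_eq_pow_finrank (K := ZMod p) (V := Tor)
    rw [hcardTor, Nat.card_zmod] at h
    exact (Nat.pow_right_injective hpp.two_le h).symm
  have hmem : ∀ {X : localPoints W (v.adicCompletion K)}, (p : ℤ) • X = 0 → X ∈ Tor := fun hX ↦
    (Submodule.mem_torsionBy_iff _ _).mpr hX
  set L₁t : Tor := ⟨L₁, hmem hL₁p⟩ with hL₁t
  set L₂t : Tor := ⟨L₂, hmem hL₂p⟩ with hL₂t
  have hsmul : ∀ (a : ZMod p) (T : Tor), ((a • T : Tor) : localPoints W (v.adicCompletion K))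
      = a.val • (T : _) := by
    intro a T
    conv_lhs => rw [← ZMod.natCast_zmod_val a, Nat.cast_smul_eq_nsmul]
    rw [AddSubgroupClass.coe_nsmul]
  have hzsmul : ∀ (z : ℤ) (T : Tor), (((z : ZMod p) • T : Tor) : localPoints W
      (v.adicCompletion K)) = z • (T : _) := by
    intro z T
    rw [Int.cast_smul_eq_zsmul, AddSubgroupClass.coe_zsmul]
  have hli : LinearIndependent (ZMod p) ![L₁t, L₂t] := by
    rw [LinearIndependent.pair_iff' (fun h ↦ hL₁0 (congrArg Subtype.val h))]
    intro a ha
    apply hA' a.val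
    have h := congrArg Subtype.val ha
    rw [hsmul] at h
    exact h.symm
  have hspan : Submodule.span (ZMod p) (Set.range ![L₁t, L₂t]) = ⊤ :=
    hli.span_eq_top_of_card_eq_finrank (by rw [hrank, Fintype.card_fin])
  have hdecomp : ∀ X : Tor, ∃ m n : ZMod p, m • L₁t + n • L₂t = X := by
    intro X
    have hX : X ∈ Submodule.span (ZMod p) (Set.range ![L₁t, L₂t]) := by
      rw [hspan]; exact Submodule.mem_top
    obtain ⟨c, hc⟩ := (Submodule.mem_span_range_iff_exists_fun (ZMod p)).mp hX
    refine ⟨c 0, c 1, ?_⟩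
    rw [Fin.sum_univ_two] at hc
    simpa using hc
  -- hence `Γ_{K_v}` acts on `E[p]` by the scalars `c(σ)`
  have hscalar : ∀ (σ : (absoluteGaloisGroup (v.adicCompletion K))) (c : ℕ), (Units.map
      (absoluteGaloisGroup.toAlgEquiv _ σ : AlgebraicClosure (v.adicCompletion K)
      →* AlgebraicClosure (v.adicCompletion K)) Z) ^ (ε σ) = Z ^ c →
      ∀ X : Tor, σ • (X : localPoints W (v.adicCompletion K)) = c • (X : localPoints W
          (v.adicCompletion K)) := by
    intro σ c hc X
    obtain ⟨m, n, hX⟩ := hdecomp X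
    have hX' : (X : localPoints W (v.adicCompletion K)) = m.val • L₁ + n.val • L₂ := by
      rw [← hX, AddSubgroup.coe_add, hsmul, hsmul]
    have hσnsmul : ∀ (k : ℕ) (Y : localPoints W (v.adicCompletion K)), σ • (k • Y) = k • (σ • Y) :=
      fun k Y ↦ map_nsmul (DistribSMul.toAddMonoidHom (localPoints W (v.adicCompletion K)) σ) k Y
    rw [hX', smul_add, hσnsmul, hσnsmul, hL₁σ σ c hc, hL₂σ σ c hc]
    simp only [smul_add, smul_smul, mul_comm]
  -- a `p`-th root `w₀` of `q` and the point `X₀ = Φ(w₀)`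
  obtain ⟨z, hz⟩ := IsAlgClosed.exists_pow_nat_eq (algebraMap (v.adicCompletion K)
      (AlgebraicClosure (v.adicCompletion K)) q) hpp.pos
  have hz0 : z ≠ 0 := by
    rintro rfl
    rw [zero_pow hpp.ne_zero] at hz
    exact hq' hz.symm
  set w₀ : (AlgebraicClosure (v.adicCompletion K))ˣ := Units.mk0 z hz0 with hw₀
  have hw₀p : (w₀ : (AlgebraicClosure (v.adicCompletion K))) ^ p = algebraMap (v.adicCompletion K)
      (AlgebraicClosure (v.adicCompletion K)) q := by
    rw [hw₀, Units.val_mk0, hz]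
  set X₀ : localPoints W (v.adicCompletion K) := Φ (Additive.ofMul w₀) with hX₀
  have hX₀p : (p : ℤ) • X₀ = 0 := by
    rw [hX₀, ← map_zsmul, ← ofMul_zpow, zpow_natCast, hker]
    exact ⟨1, by rw [zpow_one, Units.val_pow_eq_pow_val, hw₀p]⟩
  set X₀t : Tor := ⟨X₀, hmem hX₀p⟩ with hX₀t
  obtain ⟨m₀, n₀, hX₀dec⟩ := hdecomp X₀t
  have hn₀ : n₀ ≠ 0 := by
    intro hn0
    rw [hn0, zero_smul, add_zero] at hX₀dec
    have h1 : X₀ = m₀.val • L₁ := by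
      have := congrArg Subtype.val hX₀dec
      rw [hsmul] at this
      exact this.symm
    apply W.map_ofMul_mul_ne_zero_of_pow_eq v hq0 hq1 Φ hker hw₀p (ζ := (Z ^ m₀.val)⁻¹)
      (by rw [inv_pow, ← pow_mul, mul_comm, pow_mul, hZp, one_pow, inv_one])
    rw [ofMul_mul, map_add, ofMul_inv, map_neg, ofMul_pow, map_nsmul, ← hL₁, ← h1, hX₀,
      add_neg_cancel]
  -- for every `σ`: `c(σ) ≡ ε(σ) (mod p)`, hence `σ ζ₀ = ζ₀`
  intro σ
  obtain ⟨c, hc⟩ := hcyc σ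
  -- `σ w₀ = ζ w₀` with `ζ = ζ₀^k`
  set η : (AlgebraicClosure (v.adicCompletion K))ˣ := Units.map
      (absoluteGaloisGroup.toAlgEquiv _ σ : AlgebraicClosure (v.adicCompletion K)
      →* AlgebraicClosure (v.adicCompletion K)) w₀ / w₀ with hη
  have hηp : η ^ p = 1 := by
    apply Units.ext
    rw [Units.val_pow_eq_pow_val, hη, Units.val_div_eq_div_val, div_pow, Units.coe_map,
      MonoidHom.coe_coe, ← map_pow, hw₀p, AlgEquiv.commutes, div_self hq', Units.val_one]
  obtain ⟨k, -, hk⟩ := hZ.eq_pow_of_pow_eq_one (ξ := (η : (AlgebraicClosure (v.adicCompletion K))))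
    (by rw [← Units.val_pow_eq_pow_val, hηp, Units.val_one])
  have hηk : η = Z ^ k := Units.ext (by rw [← hk, Units.val_pow_eq_pow_val])
  have hσw₀ : Units.map (absoluteGaloisGroup.toAlgEquiv _ σ : AlgebraicClosure
      (v.adicCompletion K) →* AlgebraicClosure (v.adicCompletion K)) w₀ = Z ^ k * w₀ := by
    rw [← hηk, hη, div_mul_cancel]
  have hσX₀ : σ • X₀ = (ε σ * k) • L₁ + ε σ • X₀ := by
    rw [hX₀, hequiv, hσw₀, mul_zpow, ofMul_mul, map_add, ← zpow_natCast, ← zpow_mul, mul_comm,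
      ofMul_zpow, map_zsmul, ofMul_zpow, map_zsmul]
  have hσX₀' : σ • X₀ = c • X₀ := hscalar σ c hc X₀t
  have key : (((c : ℤ) - ε σ : ℤ) : ZMod p) • X₀t = ((ε σ * k : ℤ) : ZMod p) • L₁t := by
    apply Subtype.ext
    rw [hzsmul, hzsmul]
    change ((c : ℤ) - ε σ) • X₀ = (ε σ * k) • L₁
    rw [sub_zsmul, natCast_zsmul, ← hσX₀', hσX₀]
    abel
  rw [← hX₀dec, smul_add, smul_smul, smul_smul] at key
  have key' : ((((c : ℤ) - ε σ : ℤ) : ZMod p) * m₀ - ((ε σ * k : ℤ) : ZMod p)) • L₁t +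
      ((((c : ℤ) - ε σ : ℤ) : ZMod p) * n₀) • L₂t = 0 := by
    rw [sub_smul, sub_add_eq_add_sub, key, sub_self]
  obtain ⟨-, h2⟩ := LinearIndependent.pair_iff.mp hli _ _ key'
  have hcε : (((c : ℤ) - ε σ : ℤ) : ZMod p) = 0 := by
    rcases mul_eq_zero.mp h2 with h | h
    · exact h
    · exact absurd h hn₀
  have hdvd : (p : ℤ) ∣ (c : ℤ) - ε σ := (ZMod.intCast_zmod_eq_zero_iff_dvd _ p).mp hcε
  -- `(σζ₀)^ε = ζ₀^c = ζ₀^ε`, so `σ ζ₀ = ζ₀`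
  have h1 : (Units.map (absoluteGaloisGroup.toAlgEquiv _ σ : AlgebraicClosure
      (v.adicCompletion K) →* AlgebraicClosure (v.adicCompletion K)) Z) ^ (ε σ) = Z ^ (ε σ) := by
    rw [hc, ← zpow_natCast]
    exact hZzpow _ _ hdvd
  have h2 := congrArg (fun x : (AlgebraicClosure (v.adicCompletion K))ˣ ↦ x ^ (ε σ)) h1
  simp only [← zpow_mul, hεsq, zpow_one] at h2
  exact h2

/-- **A primitive `p`-th root of unity of `K̄_v` fixed by `Γ_{K_v}` lies in `K_v`**; so if `K_v`
has no non-trivial `p`-th root of unity, `Γ_{K_v}` moves `ζ₀`. (Galois descent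
`K̄_v^{Γ} = K_v`, Mathlib `InfiniteGalois.mem_range_algebraMap_iff_fixed`.) [folklore] -/
theorem false_of_forall_map_primitiveRoot_eq (hμ : ∀ ζ : (v.adicCompletion K), ζ ^ p = 1 → ζ = 1)
    {Z : (AlgebraicClosure (v.adicCompletion K))ˣ} (hZ : IsPrimitiveRoot (Z : (AlgebraicClosure
        (v.adicCompletion K))) p) (hfix : ∀ σ : (absoluteGaloisGroup (v.adicCompletion K)),
        Units.map (absoluteGaloisGroup.toAlgEquiv _ σ : AlgebraicClosure (v.adicCompletion K)
        →* AlgebraicClosure (v.adicCompletion K)) Z = Z) :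
    False := by
  have hpp : p.Prime := hp.out
  haveI : CharZero (v.adicCompletion K) := charZero_adicCompletion v
  haveI : IsGalois (v.adicCompletion K) (AlgebraicClosure (v.adicCompletion K)) := {}
  have hfix' : ∀ f : (AlgebraicClosure (v.adicCompletion K)) ≃ₐ[(v.adicCompletion K)]
      (AlgebraicClosure (v.adicCompletion K)), f (Z : (AlgebraicClosure (v.adicCompletion K)))
      = Z := by
    intro f
    have h := congrArg Units.val (hfix ((Field.absoluteGaloisGroup.toAlgEquiv
        (v.adicCompletion K)).symm f))
    rwa [Units.coe_map, MonoidHom.coe_coe, MulEquiv.apply_symm_apply] at h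
  obtain ⟨z, hz⟩ := (InfiniteGalois.mem_range_algebraMap_iff_fixed (Z : (AlgebraicClosure
      (v.adicCompletion K)))).mpr hfix'
  have hzp : z ^ p = 1 := by
    apply (algebraMap (v.adicCompletion K) (AlgebraicClosure (v.adicCompletion K))).injective
    rw [map_pow, hz, hZ.pow_eq_one, map_one]
  have hz1 : z = 1 := hμ z hzp
  apply hZ.ne_one hpp.one_lt
  rw [← hz, hz1, map_one]

omit [W.IsElliptic] in
/-- **An invariant lift for the twisted action.** For a twisted Tate parametrisation `Φ` (kernel
`q^ℤ`) with quadratic twist `L = K_v(t)`, `t² ∈ K_v`, sign `ε(σ) = ±1` (`+1` iff `σ t = t`), and an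
element `u ∈ L^*` whose norm `u · σ(u)` (`σ t ≠ t`) lies in `q^ℤ` (the shape of the `K_v`-rational
points in Silverman *ATAEC* Cor. V.5.4), the element `u' = u^{2k} q^{-km}` is INVARIANT under the
twisted action `x ↦ (σx)^{ε(σ)}` and `Φ(u') = 2k · Φ(u)`. [folklore] -/
theorem exists_twistInvariant_lift {q : (v.adicCompletion K)} (hq0 : q ≠ 0) (Φ : Additive
    (AlgebraicClosure (v.adicCompletion K))ˣ →+ localPoints W (v.adicCompletion K))
    (hker : ∀ u : (AlgebraicClosure (v.adicCompletion K))ˣ, Φ (Additive.ofMul u) = 0 ↔ ∃ n : ℤ,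
        (u : (AlgebraicClosure (v.adicCompletion K))) = algebraMap (v.adicCompletion K)
        (AlgebraicClosure (v.adicCompletion K)) q ^ n)
    {t : (AlgebraicClosure (v.adicCompletion K))} {γ : (v.adicCompletion K)} (ht2 : t ^ 2
        = algebraMap (v.adicCompletion K) (AlgebraicClosure (v.adicCompletion K)) γ) (ε :
        (absoluteGaloisGroup (v.adicCompletion K)) → ℤ)
    (hε1 : ∀ σ : (absoluteGaloisGroup (v.adicCompletion K)), Field.absoluteGaloisGroup.toAlgEquiv
        (v.adicCompletion K) σ t = t → ε σ = 1)
    (hε2 : ∀ σ : (absoluteGaloisGroup (v.adicCompletion K)), Field.absoluteGaloisGroup.toAlgEquiv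
        (v.adicCompletion K) σ t ≠ t → ε σ = -1) (k : ℕ)
    {u : (AlgebraicClosure (v.adicCompletion K))ˣ}
    (huL : ∀ σ : (absoluteGaloisGroup (v.adicCompletion K)), Field.absoluteGaloisGroup.toAlgEquiv
        (v.adicCompletion K) σ t = t → Units.map
        (absoluteGaloisGroup.toAlgEquiv _ σ : AlgebraicClosure (v.adicCompletion K)
        →* AlgebraicClosure (v.adicCompletion K)) u = u)
    (huN : ∀ σ : (absoluteGaloisGroup (v.adicCompletion K)), Field.absoluteGaloisGroup.toAlgEquiv
        (v.adicCompletion K) σ t ≠ t →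
      ∃ m : ℤ, ((u * Units.map (absoluteGaloisGroup.toAlgEquiv _ σ : AlgebraicClosure
          (v.adicCompletion K) →* AlgebraicClosure (v.adicCompletion K)) u : (AlgebraicClosure
          (v.adicCompletion K))ˣ) : (AlgebraicClosure (v.adicCompletion K))) = algebraMap
          (v.adicCompletion K) (AlgebraicClosure (v.adicCompletion K)) q ^ m) :
    ∃ u' : (AlgebraicClosure (v.adicCompletion K))ˣ, (∀ σ : (absoluteGaloisGroup
        (v.adicCompletion K)), (Units.map (absoluteGaloisGroup.toAlgEquiv _ σ : AlgebraicClosure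
        (v.adicCompletion K) →* AlgebraicClosure (v.adicCompletion K)) u') ^ (ε σ) = u') ∧
      Φ (Additive.ofMul u') = (2 * k) • Φ (Additive.ofMul u) := by
  have hq0b : algebraMap (v.adicCompletion K) (AlgebraicClosure (v.adicCompletion K)) q ≠ 0 := by
    rw [Ne, map_eq_zero_iff _ (algebraMap (v.adicCompletion K) (AlgebraicClosure
        (v.adicCompletion K))).injective]; exact hq0
  set qq : (AlgebraicClosure (v.adicCompletion K))ˣ := Units.mk0 (algebraMap (v.adicCompletion K)
      (AlgebraicClosure (v.adicCompletion K)) q) hq0b with hqq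
  have hσqq : ∀ σ : (absoluteGaloisGroup (v.adicCompletion K)), Units.map
      (absoluteGaloisGroup.toAlgEquiv _ σ : AlgebraicClosure (v.adicCompletion K)
      →* AlgebraicClosure (v.adicCompletion K)) qq = qq := fun σ ↦
    Units.ext (by rw [Units.coe_map, MonoidHom.coe_coe, hqq, Units.val_mk0, AlgEquiv.commutes])
  have hΦqq : Φ (Additive.ofMul qq) = 0 :=
    (hker qq).mpr ⟨1, by rw [zpow_one, hqq, Units.val_mk0]⟩
  by_cases hsplit : ∀ σ : (absoluteGaloisGroup (v.adicCompletion K)),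
      Field.absoluteGaloisGroup.toAlgEquiv (v.adicCompletion K) σ t = t
  · refine ⟨u ^ (2 * k), fun σ ↦ ?_, by rw [ofMul_pow, map_nsmul]⟩
    rw [hε1 σ (hsplit σ), zpow_one, map_pow, huL σ (hsplit σ)]
  · obtain ⟨σ₀, hσ₀⟩ := not_forall.mp hsplit
    obtain ⟨m, hm⟩ := huN σ₀ hσ₀
    have hmU : u * Units.map (absoluteGaloisGroup.toAlgEquiv _ σ₀ : AlgebraicClosure
        (v.adicCompletion K) →* AlgebraicClosure (v.adicCompletion K)) u = qq ^ m := Units.ext (by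
      rw [hm, Units.val_zpow_eq_zpow_val, hqq, Units.val_mk0])
    have hσ₀u : Units.map (absoluteGaloisGroup.toAlgEquiv _ σ₀ : AlgebraicClosure
        (v.adicCompletion K) →* AlgebraicClosure (v.adicCompletion K)) u = u⁻¹ * qq ^ m
        := eq_inv_mul_of_mul_eq hmU
    -- any `σ` moving `t` maps it to `-t`, and acts on `u ∈ L` as `σ₀` does
    have hmove : ∀ σ : (absoluteGaloisGroup (v.adicCompletion K)),
        Field.absoluteGaloisGroup.toAlgEquiv (v.adicCompletion K) σ t ≠ t →
        Field.absoluteGaloisGroup.toAlgEquiv (v.adicCompletion K) σ t = -t := by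
      intro σ hσ
      have h2 : (Field.absoluteGaloisGroup.toAlgEquiv (v.adicCompletion K) σ t) ^ 2 = t ^ 2 := by
        rw [← map_pow, ht2, AlgEquiv.commutes]
      rcases sq_eq_sq_iff_eq_or_eq_neg.mp h2 with h | h
      · exact absurd h hσ
      · exact h
    have hs : (Field.absoluteGaloisGroup.toAlgEquiv (v.adicCompletion K) σ₀).symm t = -t := by
      apply (Field.absoluteGaloisGroup.toAlgEquiv (v.adicCompletion K) σ₀).injective
      rw [AlgEquiv.apply_symm_apply, map_neg, hmove σ₀ hσ₀, neg_neg]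
    have hσu : ∀ σ : (absoluteGaloisGroup (v.adicCompletion K)),
        Field.absoluteGaloisGroup.toAlgEquiv (v.adicCompletion K) σ t ≠ t →
        Units.map (absoluteGaloisGroup.toAlgEquiv _ σ : AlgebraicClosure (v.adicCompletion K)
            →* AlgebraicClosure (v.adicCompletion K)) u = Units.map
            (absoluteGaloisGroup.toAlgEquiv _ σ₀ : AlgebraicClosure (v.adicCompletion K)
            →* AlgebraicClosure (v.adicCompletion K)) u := by
      intro σ hσ
      have hτ : Field.absoluteGaloisGroup.toAlgEquiv (v.adicCompletion K) (σ₀⁻¹ * σ) t = t := by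
        rw [map_mul, map_inv, AlgEquiv.mul_apply, hmove σ hσ, AlgEquiv.aut_inv, map_neg, hs,
          neg_neg]
      have h := congrArg Units.val (huL _ hτ)
      rw [Units.coe_map, MonoidHom.coe_coe, map_mul, map_inv, AlgEquiv.mul_apply,
        AlgEquiv.aut_inv, AlgEquiv.symm_apply_eq] at h
      exact Units.ext (by rw [Units.coe_map, MonoidHom.coe_coe, Units.coe_map,
        MonoidHom.coe_coe, h])
    refine ⟨u ^ (2 * k) * (qq ^ ((k : ℤ) * m))⁻¹, fun σ ↦ ?_, ?_⟩
    · by_cases hσ : Field.absoluteGaloisGroup.toAlgEquiv (v.adicCompletion K) σ t = t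
      · rw [hε1 σ hσ, zpow_one, map_mul, map_inv, map_pow, map_zpow, huL σ hσ, hσqq σ]
      · rw [hε2 σ hσ, map_mul, map_inv, map_pow, map_zpow, hσu σ hσ, hσqq σ, hσ₀u]
        apply Additive.ofMul.injective
        simp only [ofMul_zpow, ofMul_mul, ofMul_inv, ofMul_pow]
        module
    · rw [ofMul_mul, ofMul_inv, map_add, map_neg, ofMul_pow, map_nsmul, ofMul_zpow, map_zsmul,
        hΦqq, zsmul_zero, neg_zero, add_zero]

end Local

end WeierstrassCurve

end
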